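import Summits.QuantumFields.YangMills.Theorems.BalabanUVNodesK0AxTangentSocketCritFlat
import Summits.QuantumFields.YangMills.Theorems.BalabanUVNodesK0AxTangentSocketConsNeg
import Summits.QuantumFields.YangMills.Theorems.BalabanUVNodesK0Stub1FlatAveragingDictionary
import Summits.QuantumFields.YangMills.Theorems.BalabanUVNodesPortU8WindowDomains
import Summits.QuantumFields.YangMills.Theorems.BalabanUVNodesN07LinearisedAveragingKernel
import Summits.QuantumFields.YangMills.Theorems.BalabanUVNodesN12MinimiserFamilyAtRecordBjNoPlaqGuard
import HarnessLib

/-!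
# BalabanUVNodes ∕ K0ᴬ — THE CONSTRAINT HALF OF THE JUNCTION, FIRST ORDER, MODULO GAUGE: (J-cons″) AT THE FLAT LOG CHART IS A THEOREM, and the (R-a) road at `Ψ₀` gets a
contentful final (MINT NODE O, lens-1 g11, FILE 11; `--supports stmt-QuantumFields-27238 --as helper`)

LANDING NOTE (porter ▶ PTC-1 g4, 2026-08-31; AUTHORSHIP = ◇ lens-1 g11 «cauchy-analytic», HOME sketch `nodeO-cover/LENS-1g11-TangentSocketModGauge-v1.lean` sha16 3f857e80419ca706 · 570 l. · 16
thm, no `def`, 0 sorry (CANDIDATE 9 = FILE 11: the THEOREM edition — (J-cons″) AT THE FLAT LOG CHART IS A THEOREM (`flatConsModGauge_msChart_flat`, comb re-gauging `φ₀ := Λ_{k+1}(↑Y) ∘ iterBlockOf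
(k+1)`), the MOD-GAUGE socket, and the (R-a) road's CONTENTFUL final at Ψ₀ `rootedReceipts_of_tokens_atScale_flatLogChart_modGauge` with NO dictionary displayed; ◆'s CUT RULE honoured: no
`FlatConsDictionary … Ψ₀ _` binder, none of the four vacuous finals consumed)): the HOME file exceeds the gate's 400-line cap, so it is landed as TWO files by a MECHANICAL split at the §3∕§4
boundary (generator `work/gen/build_split_modgauge.py` of this seat; docstrings, statements and proofs BYTE-IDENTICAL; imports as the monolith): FILE 11A
`…Theorems/BalabanUVNodesK0AxTangentSocketModGaugeComb.lean` = header + §1 Plumbing + §2 CombRegauge + §3 DatumVelocity (8 thm), FILE 11B `…Theorems/BalabanUVNodesK0AxTangentSocketModGauge.lean`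
(◇'s basename) = header + `import …K0AxTangentSocketModGaugeComb` + the same preamble + §4 ModGaugeSocket + §5 FlatLogChartFinal (8 thm). THIS IS FILE 11A (the other:
`…K0AxTangentSocketModGauge`).  Landed after ✓p823070 `…ConsNeg` and ★★ DEF-1 g38's ✓p823088 `…CritFlat` (`flatCritDictionary_flatLogChart` cited by name); ◆ CRIT-1 g38's cut: «CUT — CANDIDATE 9 →
GO VERBATIM, filed as PTC-1's mechanical SPLIT 11A + 11B (570 l. > the cap ⇒ split REQUIRED); axioms standard on ALL 16 (guarded); J5′: no def∕private∕options; J4 16 × 0; J1′ CUT RULE honoured (no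
consumed `FlatConsDictionary … Ψ₀` binder); MECHANICAL BINDER CUSTODY of the ★★★★ final vs ✓Onto :155 — 23 binders identical, ONLY-in-Onto = {Jcrit, Jcons}, ONLY-here = {hρ8}, conclusion EQUAL;
(Q-ord): `∃ φ₀` INSIDE `∀ Y`; SAME-WALL: SURVIVES, priced — both J-letters are now THEOREMS at Ψ₀, so the final at Ψ₀ is NON-VACUOUS modulo the displayed tokens» (nodeO STATUS
2026-08-31T12:56:21Z); ◇ lens-1 g11 SPLIT ACK (l.5445); `--supports stmt-QuantumFields-27238 --as helper` (NO `--workitem`; kind proof).  HONEST (porter): calculus ∕ linear algebra over tree facts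
+ CONDITIONAL finals over DISPLAYED tokens (KNIT tokens, `RegimeTok`, (s-exp) letters, `ρ₈ ⊂ 𝔰𝔲(2)`, D1 ⟨27930⟩) inhabited NOWHERE as a package; (C-tab-opt) STRUCK; nothing of Bałaban asserted,
ported, discharged or refuted; K0ᴬ stmt-QuantumFields-27238 ∕ K0⁷ 20541 OPEN — NOTHING of them proved; NODE O 0∕1; COUNT 8∕28 · K 1∕4 UNMOVED; finite 𝕋⁴ at fixed ε — NOT continuum ∕ OS ∕ Clay; the
Yang–Mills mass gap is NOT proved by any of this.

WHAT DIED AND WHAT REPLACES IT.  The EXACT flat constraint dictionary (J-cons′) `FlatConsDictionary F θ k K Ψ₀ datum` («`DΨ₀(0)Y = D datum(0)(respDir a l)` ⟹ the straight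
[B6]-constraint rows `QE(univDomains)(re∕im ξ⁻¹Y_{ii′}) = (ρ₈ bV a)_{ii′} • windowSrc univ l`») is FALSE at the canonical flat logarithmic chart
`Ψ₀ := msChart F 2 K (k+1) (atScale (k+1)) Ū(1) 1` (✓`not_flatConsDictionary_msChart_flat`: `DΨ₀(0)` kills pure gradients, the straight rows do not), so the four landed `Ψ₀`-finals
(✓`rootedReceipts_of_tokens_atScale_flatLogChart`, ✓`…_onto`, ✓`…_lie`, ✓`…_recordScheme`) are vacuous as typed.  The repaired letter (J-cons″) asks for the rows only MODULO AN
UNRESTRICTED SITE POTENTIAL `φ₀ : Site 0 → (Fin 2 → Fin 2 → ℂ)` — exactly what the mod-gauge receipt (C-cons) `RootedResponseConstraintModGaugeAt` and its chart twin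
`ChartResponseCriticalModGaugeAt` (✓`criticalModGauge_iff_chart`) consume — and AT `Ψ₀` WITH DATUM `Ψ₀ ∘ X` IT IS A THEOREM, proved here (§4 ★★★`flatConsModGauge_msChart_flat`).

THE MECHANISM (§2–§3).  (i) COMB REGAUGE (§2): for every Lie field `Y` on the fine bonds, the comb functional `Λ_{k+1}(↑Y)` of k0-s1-w1's ✓`qLin_one_eq_sub_comb`, pulled back along
`iterBlockOf (k+1)` to a site potential `φ₀` on the fine lattice, turns the PLAIN iterated bond average of `ξ⁻¹(Y − ∂φ₀)` into the linearised averaging map: `bondAvgIter (k+1) (ξ⁻¹(Y − ∂φ₀)) c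
= qLin (k+1) 1 Y c` (★`exists_blockGauge_bondAvgIter_eq_qLin`; ✓`bondAvgIter_grad`, `siteAvgIter ∘ iterBlockOf = id`); read through [B6]'s `QE` on `univDomains` (only the top level
carries constraints, ✓`lamBond_windowDomains_*`) this gives the mod-gauge rows from any prescription of `qLin Y` on the coarse bonds (★`exists_blockGauge_QE_eq_of_qLin_eq`).
(ii) DATUM VELOCITY (§3): the KNIT `range` token's eventual identity `Ū^{k+1}(expChart 1 (X B)) = unitField B` near `B = 0` (✓`eventually_avgFamily_expChart_eq_unitField`), `X 0 = 0`,
`X` differentiable at `0` and `ρ₈ ∈ 𝔰𝔲(2)` force, by the chain rule against the explicit CLM `B ↦ suProj (ρ₈ (B c.dir c.src))` (✓`mlog_exp`, ✓`fderiv_msChart_apply_eq_suProj_qLin_of_smallBelow`),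
`qLin (k+1) 1 (DX(0)·respDir a l) c = [c = ⟨l.2,l.1⟩] ρ₈(bV a)` (★★`qLin_fderiv_respDir_eq`); and `DΨ₀(0)Y = DΨ₀(0)Y′ ⟹ qLin Y = qLin Y′` (★`qLin_eq_of_fderiv_msChart_flat_eq`).
(iii) §4: (i)+(ii) ⟹ ★★★`flatConsModGauge_msChart_flat` — (J-cons″)@`Ψ₀`; the MOD-GAUGE TANGENT SOCKET ★★`chartResponseCriticalModGauge_of_tangentData` (pure logic, twin of
✓`chartResponseWeaklyCritical_of_tangentData`; criticality is blind to `φ₀` by ✓`dcE_reBond_mul_sub_grad`); receipts ★★★`rootedReceipts_of_chart_criticalModGauge`; the socket plugged into a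
flat tangent-critical exp-chart family for a GENERIC `Ψ` with (J-crit′) + (J-cons″) displayed (★★★`chartResponseCriticalModGauge_of_flatCriticalExpChartFamily`) and AT `Ψ₀` WITH NO
DICTIONARY DISPLAYED (★★★`…_flatLogChart`: (J-crit′)@`Ψ₀` is DEF-1's ✓`flatCritDictionary_flatLogChart`, (J-cons″)@`Ψ₀` is §4); ★★★`rootedReceipts_of_flatExpChartFamily_flatLogChart`.
(iv) §5: ★★★★`rootedReceipts_of_tokens_atScale_flatLogChart_modGauge` — the (R-a) road at `Ψ₀` RE-THREADED (✓Near ∕ ✓Dock ∕ ✓Psi lemmas reused by name): DISPLAYED = `k + 2 ≤ m + K` ·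
N07's KNIT tokens `(Kc range covers sol_of_isMinOn star_mem star_isMinOn)` + `RegimeTok` + domain letter · the datum family `W` · (s-exp) `hSX` with `X 0 = 0`, `X ∈ C²` at `0` · `ρ₈ ∈ 𝔰𝔲(2)`
— NO `Ψ`-letter, NO (J-crit′), NO (J-cons′) ⟹ (∀ a l, the four rooted receipts (C-wcg) ∧ (C-orb) ∧ (C-crit) ∧ (C-cons)) ∧ TokP9reg♭ᵣ; and ✓`not_flatConsDictionary_msChart_flat` with its
onto-ness discharged (`…_of_le`).  The downstream specialisations (✓`…_lie`, ✓`…_recordScheme`: `X := S.lieExpo ∘ unitField`, the scheme of record) re-thread by the same one-line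
substitution of this final for ✓`…_onto` — left to the porter ∕ successor (their displayed `Jcrit Jcons` binders simply drop).

HONEST.  Finite-dimensional calculus and lattice bookkeeping over the tree's own operators ([B6] Sect. A `QE ∕ dcE ∕ windowSrc`, k0-s1-w1's flat averaging dictionary, n07-e's `msChart`,
dag-n12's onto-ness, def-Y's tokens) — every input a kernel-checked tree theorem; CONDITIONAL over the DISPLAYED KNIT ∕ (s-exp) letters, inhabited NOWHERE in the tree; nothing of Bałaban
([15] Thm 1, Prop. 3, Prop. 6–9, (44)–(48), (82)–(83), (176)–(178); [14] (2.6)–(2.8), (2.35); [RS] (1.113)–(1.114); [III] (2.10)–(2.13); [I] (1.20), (4.35)) is asserted, ported or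
discharged beyond what the tree already proves; (C-tab-opt) stays STRUCK (№543) and (J-cons′)@`Ψ₀` stays REFUTED-MISSTATED (◆ l.5399) — this file is its mod-gauge REPAIR, not a
re-filing; K0ᴬ `stmt-QuantumFields-27238` ∕ K0⁷ `stmt-QuantumFields-20541` remain OPEN — NOTHING of them is proved here; NODE O 0∕1; COUNT 8∕28 · K 1∕4 UNMOVED; finite 𝕋⁴_{L^K} at
fixed ε — NOT continuum ∕ OS ∕ Clay; **the Yang–Mills mass gap is NOT proved by any of this.**  No `sorry`, no `def`, no `instance ∕ notation ∕ set_option`; standard axioms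
`[propext, Classical.choice, Quot.sound]`.
-/

noncomputable section

open Filter Topology
open scoped BigOperators Matrix.Norms.L2Operator
open scoped InnerProductSpace

namespace Summit.QuantumFields.YangMills.Theorems.K0AxCtabUniq

open Literature.MathematicalPhysics.QuantumFieldTheory.Balaban1983to89
open LatticeFieldCalculus B6SectADomainsV1 B6SectAOperatorsV1 B6SectAVectorModelV1 B6SectACriticalPointV1
open Literature.MathematicalPhysics.QuantumFieldTheory.Balaban1983to89.T4Continuum (T4Family)
open Literature.MathematicalPhysics.QuantumFieldTheory.Balaban1983to89.Node00
open T4RootedResidualGauge (rootGauge)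
open GaugeField (gaugeAct)
open B12GaugeOrbits021 (IsResidual OrbitRel)
open B11Prop6Scheme (mapT)
open Summit.QuantumFields.YangMills.Theorems.K0RecordFormatNames
open Summit.QuantumFields.YangMills.Theorems.K0AxRootGrad
open T4AdjointCovarianceUnitary (lieSU mem_lieSU_iff exp_mem_specialUnitaryGroup_of_mem_lieSU)
open B15DeterminingSets (DetSet MSField atScale embIter avgFamily bondsOf)
open B5Eq118OneStroke (iterBlockOf iterBlock mem_iterBlock siteAvgIter_eq_blockSum card_iterBlock)
open B5Eq120IterProof (bondAvgIter_grad)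
open B6SectAOntoV1 (bondAvgIterLin bondAvgIterLin_apply)
open Literature.MathematicalPhysics.QuantumFieldTheory.BalabanImbrieJaffe1984to88.BIJ85AxialPropagator411 (BondSpace)
open Literature.MathematicalPhysics.QuantumFieldTheory.BalabanImbrieJaffe1984to88.BIJ88RT51Background (iterBlockOf_embIter)
open Summit.QuantumFields.YangMills.Theorems.ChartHInv (exists_combFamily bondAvgIter_comp_apply)
open Summit.QuantumFields.YangMills.Theorems.K0Stub1FlatAveragingDictionary (qLin_one_eq_sub_comb combFamily_mem_lieSU)
open Summit.QuantumFields.YangMills.Theorems.PortU8 (exists_iterBlockOf_eq lamBond_windowDomains_zero_iff not_lamBond_windowDomains_mid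
  lamBond_windowDomains_top_iff windowSrc_apply)
open Summit.QuantumFields.YangMills.BalabanUVNodes.N07LinearisedAveragingKernel (qLin_mem_lieSU)
open Summit.QuantumFields.YangMills.BalabanUVNodes.N12MinimiserFamilyAtRecordBjNoPlaqGuard (fderiv_msChart_apply_eq_suProj_qLin_of_smallBelow)
open Summit.QuantumFields.YangMills.Theorems.BalabanUVNodesPortS1 (unitField_zero)
open MatrixLog (mlog)
open Literature.MathematicalPhysics.QuantumFieldTheory.Balaban1983to89.B7BlockAvgLog (mlog_exp)

variable (F : T4Family) (θ : Stage13Params F 2)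

/-! ## §1  The [B6] Sect. A index set of the WHOLE-TORUS domain family `univDomains`: only the top level, and the value row `r • windowSrc univ l` unfolded -/

section Plumbing

/-- Every constraint index of `univDomains F k K hk` (= ✓`windowDomains … Finset.univ`) sits at the TOP level `k + 1` (levels `1 … k` are empty, level `0` is
the complement of the whole torus). [cite: Balaban1984PropagatorsII, (2.3)–(2.6) p.224 (bookkeeping)] -/
theorem bondIdx_univDomains_level {K k : ℕ} (hk : k + 1 ≤ (F.P K).m + (F.P K).K) (i : BondIdx (univDomains F k K hk)) :
    ((i.1.1 : ℕ)) = k + 1 := by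
  obtain ⟨⟨⟨j, hj⟩, c⟩, hc⟩ := i
  show j = k + 1
  have hj' : j < k + 1 + 1 := hj
  by_contra hne
  rcases Nat.eq_zero_or_pos j with rfl | hj0
  · exact ((lamBond_windowDomains_zero_iff F hk Finset.univ c).1 hc).1 (Finset.mem_univ _)
  · exact not_lamBond_windowDomains_mid F hk Finset.univ hj0 (by omega) c hc

/-- The value row unfolded: a bond function whose top-level straight average is `r` on the coarse bond `l` and `0` elsewhere has [B6]-constraint `r • windowSrc univ l`.
[cite: Balaban1984PropagatorsII, (2.6) p.224; Balaban1985Variational, (18) p.281 (bookkeeping)] -/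
theorem QE_univDomains_eq_smul_windowSrc {K k : ℕ} (hk : k + 1 ≤ (F.P K).m + (F.P K).K) (r : ℝ) (l : RespLabel F k K) (x : BondSpace (F.P K))
    (h : ∀ c : PBond (F.P K) (k + 1), bondAvgIter (k + 1) (WithLp.ofLp x) c = if c = ⟨l.2, l.1⟩ then r else 0) :
    QE (univDomains F k K hk) x = r • windowSrc F k K hk Finset.univ l := by
  ext i
  have hlev := bondIdx_univDomains_level F hk i
  obtain ⟨⟨⟨j, hj⟩, c⟩, hc⟩ := i
  change j = k + 1 at hlev
  subst hlev
  rw [QE_apply]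
  change bondAvgIter (k + 1) (WithLp.ofLp x) c = (r • windowSrc F k K hk Finset.univ l) ⟨⟨⟨k + 1, hj⟩, c⟩, hc⟩
  rw [h c, WithLp.ofLp_smul, Pi.smul_apply, windowSrc_apply]
  have hex : (∃ x : Site (F.P K) 0, iterBlockOf (k + 1) x = c.src ∧ iterBlockOf (k + 1) x = l.2) ↔ c.src = l.2 := by
    constructor
    · rintro ⟨x, h1, h2⟩
      rw [← h1, ← h2]
    · intro h'
      obtain ⟨x, hx⟩ := exists_iterBlockOf_eq F K (k + 1) hk c.src
      exact ⟨x, hx, hx.trans h'⟩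
  obtain ⟨y, μ⟩ := c
  simp only [Fin.val_mk, true_and, PBond.mk.injEq, smul_eq_mul, mul_ite, mul_one, mul_zero] at hex ⊢
  simp only [hex]
  by_cases hy : y = l.2 <;> by_cases hμ : μ = l.1 <;> simp [hy, hμ]

end Plumbing

/-! ## §2  THE COMB RE-GAUGING ([15] (44)–(48) ↔ [B6] (2.6)): modulo the block-constant potential `φ₀ := Λ_{k+1}(Y) ∘ B^{k+1}`, the STRAIGHT scaled average `Q_{k+1}(ξ⁻¹(Y − ∂φ₀))` IS the
contour-linearised average `Q̄_{k+1}(1)Y` -/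

section CombRegauge

/-- `Q′_k` fixes block-constant functions: `Q′_k (g ∘ B^k) = g`. [cite: Balaban1984PropagatorsI, (1.18) p.20 (bookkeeping)] -/
theorem siteAvgIter_comp_iterBlockOf {P : Params} {V : Type*} [AddCommGroup V] [Module ℝ V] {k : ℕ} (hk : k ≤ P.m + P.K) (g : Site P k → V) :
    siteAvgIter k (fun x => g (iterBlockOf k x)) = g := by
  funext y
  rw [siteAvgIter_eq_blockSum k hk _ y]
  have hsum : ∑ x ∈ iterBlock k y, g (iterBlockOf k x) = ∑ x ∈ iterBlock k y, g y :=
    Finset.sum_congr rfl fun x hx => by rw [(mem_iterBlock k y x).1 hx]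
  rw [hsum, Finset.sum_const, card_iterBlock k hk y, ← Nat.cast_smul_eq_nsmul ℝ, smul_smul, Nat.cast_pow, Nat.cast_pow,
    inv_mul_cancel₀ (by have := P.L_pos; positivity), one_smul]

/-- ★ **THE COMB RE-GAUGING**: for every `𝔰𝔲(2)`-valued fine field `Y` there is a site potential `φ₀` (Bałaban's comb functional `Λ_{k+1}(Y)` of [15] (46)–(48), made
block-constant on the fine lattice) with `Q_{k+1}(ξ⁻¹·(Y − ∂φ₀)) = Q̄_{k+1}(1) Y` EXACTLY (`ξ⁻¹ = L^{k+1}`): the straight [B6] average of the re-gauged field is the contour-linearised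
average.  (✓`qLin_one_eq_sub_comb` + ✓`bondAvgIter_grad` + `Q′` fixes block-constants.) [cite: Balaban1985Variational, (44)–(48) p.285; Balaban1984PropagatorsII, (2.6)–(2.7) p.224;
Balaban1984PropagatorsI, (1.18) p.20] -/
theorem exists_blockGauge_bondAvgIter_eq_qLin {K k : ℕ} (hk : k + 1 ≤ (F.P K).m + (F.P K).K) (Y : PBond (F.P K) 0 → lieSU (Fin 2)) :
    ∃ φ₀ : Site (F.P K) 0 → Matrix (Fin 2) (Fin 2) ℂ, ∀ c : PBond (F.P K) (k + 1),
      bondAvgIter (k + 1) (fun b => (((F.P K).eta (k + 1))⁻¹ : ℂ) • ((Y b : Matrix (Fin 2) (Fin 2) ℂ) - (φ₀ b.tgt - φ₀ b.src))) c =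
        qLin (k + 1) (1 : GaugeField (F.P K) 0 (SU 2)) Y c := by
  obtain ⟨Λ, hΛ0, hΛs⟩ := exists_combFamily (P := F.P K) (n := Fin 2)
  refine ⟨fun x => Λ (k + 1) (fun b => (Y b : Matrix (Fin 2) (Fin 2) ℂ)) (iterBlockOf (k + 1) x), fun c => ?_⟩
  have hL : ((F.P K).L : ℂ) ≠ 0 := by exact_mod_cast (F.P K).L_pos.ne'
  have hξ : (((F.P K).eta (k + 1))⁻¹ : ℂ) = ((F.P K).L : ℂ) ^ (k + 1) := by
    simp only [Params.eta, Complex.ofReal_pow, Complex.ofReal_inv, Complex.ofReal_natCast, inv_pow, inv_inv]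
  -- linearity of the straight average
  have hlin : bondAvgIter (k + 1) (fun b => (((F.P K).eta (k + 1))⁻¹ : ℂ) • ((Y b : Matrix (Fin 2) (Fin 2) ℂ) -
      ((fun x => Λ (k + 1) (fun b => (Y b : Matrix (Fin 2) (Fin 2) ℂ)) (iterBlockOf (k + 1) x)) b.tgt -
        (fun x => Λ (k + 1) (fun b => (Y b : Matrix (Fin 2) (Fin 2) ℂ)) (iterBlockOf (k + 1) x)) b.src))) c =
      (((F.P K).eta (k + 1))⁻¹ : ℂ) • (bondAvgIter (k + 1) (fun b => (Y b : Matrix (Fin 2) (Fin 2) ℂ)) c -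
        bondAvgIter (k + 1) (grad (1 : ℝ) fun x => Λ (k + 1) (fun b => (Y b : Matrix (Fin 2) (Fin 2) ℂ)) (iterBlockOf (k + 1) x)) c) := by
    rw [ChartHInv.bondAvgIter_const_smul]
    congr 1
    have hfun : (fun b : PBond (F.P K) 0 => (Y b : Matrix (Fin 2) (Fin 2) ℂ) -
        ((fun x => Λ (k + 1) (fun b => (Y b : Matrix (Fin 2) (Fin 2) ℂ)) (iterBlockOf (k + 1) x)) b.tgt -
          (fun x => Λ (k + 1) (fun b => (Y b : Matrix (Fin 2) (Fin 2) ℂ)) (iterBlockOf (k + 1) x)) b.src)) =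
        (fun b => (Y b : Matrix (Fin 2) (Fin 2) ℂ)) -
          grad (1 : ℝ) fun x => Λ (k + 1) (fun b => (Y b : Matrix (Fin 2) (Fin 2) ℂ)) (iterBlockOf (k + 1) x) := by
      funext b
      simp only [Pi.sub_apply, LatticeFieldCalculus.grad, one_smul]
    rw [hfun]
    exact congrFun (map_sub (bondAvgIterLin (F.P K) (Matrix (Fin 2) (Fin 2) ℂ) (k + 1)) _ _) c
  rw [hlin, bondAvgIter_grad (k + 1) hk, siteAvgIter_comp_iterBlockOf hk, qLin_one_eq_sub_comb Λ hΛ0 hΛs (k + 1) Y c, hξ]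
  have hsc : ((F.P K).L : ℂ) ^ (k + 1) * (((1 : ℝ) / ((F.P K).L : ℝ) ^ (k + 1) : ℝ) : ℂ) = 1 := by
    push_cast
    field_simp
  have hgr : (((F.P K).L : ℂ) ^ (k + 1)) • grad ((1 : ℝ) / ((F.P K).L : ℝ) ^ (k + 1)) (Λ (k + 1) fun b => (Y b : Matrix (Fin 2) (Fin 2) ℂ)) c =
      Λ (k + 1) (fun b => (Y b : Matrix (Fin 2) (Fin 2) ℂ)) c.tgt - Λ (k + 1) (fun b => (Y b : Matrix (Fin 2) (Fin 2) ℂ)) c.src := by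
    ext i j
    simp only [LatticeFieldCalculus.grad, Matrix.smul_apply, Matrix.sub_apply, Complex.real_smul, smul_eq_mul, ← mul_assoc, hsc, one_mul]
  rw [smul_sub, hgr, ← Nat.cast_smul_eq_nsmul ℂ, Nat.cast_pow]

/-- Entry ∕ real-part reading of ★`exists_blockGauge_bondAvgIter_eq_qLin` in DEF-1's K0 letters: if `Q̄_{k+1}(1) Y` is the value row `δ_{c,l}·M`, then for the comb potential `φ₀`
the [B6]-constraint of the re-gauged scaled entries is `(M_{ii′}).re∕im • windowSrc univ l`. [cite: Balaban1985Variational, (44)–(48) p.285, (18) p.281; Balaban1984PropagatorsII,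
(2.6)–(2.7) p.224] -/
theorem exists_blockGauge_QE_eq_of_qLin_eq {K k : ℕ} (hk : k + 1 ≤ (F.P K).m + (F.P K).K) (Y : PBond (F.P K) 0 → lieSU (Fin 2))
    (M : Matrix (Fin 2) (Fin 2) ℂ) (l : RespLabel F k K)
    (hq : ∀ c : PBond (F.P K) (k + 1), qLin (k + 1) (1 : GaugeField (F.P K) 0 (SU 2)) Y c = if c = ⟨l.2, l.1⟩ then M else 0) :
    ∃ φ₀ : Site (F.P K) 0 → Fin 2 → Fin 2 → ℂ, ∀ i i' : Fin 2,
      QE (univDomains F k K hk) (reBond F K fun b => (((F.P K).eta (k + 1))⁻¹ : ℂ) *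
          ((Y b : Matrix (Fin 2) (Fin 2) ℂ) i i' - (φ₀ b.tgt i i' - φ₀ b.src i i'))) = (M i i').re • windowSrc F k K hk Finset.univ l ∧
      QE (univDomains F k K hk) (imBond F K fun b => (((F.P K).eta (k + 1))⁻¹ : ℂ) *
          ((Y b : Matrix (Fin 2) (Fin 2) ℂ) i i' - (φ₀ b.tgt i i' - φ₀ b.src i i'))) = (M i i').im • windowSrc F k K hk Finset.univ l := by
  obtain ⟨φ₀, hφ₀⟩ := exists_blockGauge_bondAvgIter_eq_qLin F hk Y
  refine ⟨fun x i i' => φ₀ x i i', fun i i' => ⟨?_, ?_⟩⟩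
  · refine QE_univDomains_eq_smul_windowSrc F hk _ l _ fun c => ?_
    -- the real part of the `(i,i′)` entry commutes with the straight average
    let π : Matrix (Fin 2) (Fin 2) ℂ →ₗ[ℝ] ℝ := Complex.reLm.comp (LinearMap.proj i' ∘ₗ LinearMap.proj i)
    have hπ : ∀ A : Matrix (Fin 2) (Fin 2) ℂ, π A = (A i i').re := fun A => rfl
    have h1 : (WithLp.ofLp (reBond F K fun b => (((F.P K).eta (k + 1))⁻¹ : ℂ) *
        ((Y b : Matrix (Fin 2) (Fin 2) ℂ) i i' - (φ₀ b.tgt i i' - φ₀ b.src i i')))) =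
        fun b => π ((((F.P K).eta (k + 1))⁻¹ : ℂ) • ((Y b : Matrix (Fin 2) (Fin 2) ℂ) - (φ₀ b.tgt - φ₀ b.src))) := by
      funext b
      simp only [reBond, WithLp.ofLp_toLp, hπ, Matrix.smul_apply, Matrix.sub_apply, smul_eq_mul]
    rw [h1, bondAvgIter_comp_apply π (k + 1), hφ₀ c, hπ, hq c]
    split_ifs <;> simp
  · refine QE_univDomains_eq_smul_windowSrc F hk _ l _ fun c => ?_
    let π : Matrix (Fin 2) (Fin 2) ℂ →ₗ[ℝ] ℝ := Complex.imLm.comp (LinearMap.proj i' ∘ₗ LinearMap.proj i)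
    have hπ : ∀ A : Matrix (Fin 2) (Fin 2) ℂ, π A = (A i i').im := fun A => rfl
    have h1 : (WithLp.ofLp (imBond F K fun b => (((F.P K).eta (k + 1))⁻¹ : ℂ) *
        ((Y b : Matrix (Fin 2) (Fin 2) ℂ) i i' - (φ₀ b.tgt i i' - φ₀ b.src i i')))) =
        fun b => π ((((F.P K).eta (k + 1))⁻¹ : ℂ) • ((Y b : Matrix (Fin 2) (Fin 2) ℂ) - (φ₀ b.tgt - φ₀ b.src))) := by
      funext b
      simp only [imBond, WithLp.ofLp_toLp, hπ, Matrix.smul_apply, Matrix.sub_apply, smul_eq_mul]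
    rw [h1, bondAvgIter_comp_apply π (k + 1), hφ₀ c, hπ, hq c]
    split_ifs <;> simp

end CombRegauge

/-! ## §3  THE FIRST-ORDER READING OF THE KNIT `range` TOKEN: the datum velocity through the flat log chart has contour-linearised average `δ_{c,l}·ρ₈(bV a)` -/

section DatumVelocity

/-- The response direction read through `ρ₈`, bond by bond: `ρ₈((e_l ⊗ bV a)(c)) = δ_{c,l}·ρ₈(bV a)`. [cite: Balaban1987RG1, (1.20) p.264 (bookkeeping)] -/
theorem ρ8_respDir_apply (k K : ℕ) (a : θ.ιβ) (l : RespLabel F k K) (c : PBond (F.P K) (k + 1)) :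
    letI := θ.instVβ₁; letI := θ.instVβ₂
    θ.ρ8 (respDir F θ k K a l c.dir c.src) = if c = ⟨l.2, l.1⟩ then θ.ρ8 (θ.bV a) else 0 := by
  obtain ⟨y, μ⟩ := c
  letI := θ.instVβ₁; letI := θ.instVβ₂
  simp only [respDir, PBond.mk.injEq]
  by_cases hμ : μ = l.1
  · subst hμ
    by_cases hy : y = l.2
    · subst hy
      simp
    · rw [Pi.single_eq_same, Pi.single_eq_of_ne hy, map_zero, if_neg (fun h => hy h.1)]
  · rw [Pi.single_eq_of_ne hμ, Pi.zero_apply, map_zero, if_neg (fun h => hμ h.2)]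

/-- The chart derivative of the FLAT LOG CHART `Ψ₀` determines the contour-linearised averages `Q̄_{k+1}(1)` (every top-level bond is a constraint index of `atScale (k+1)`, and `suProj`
is injective on `𝔰𝔲(2)`): `DΨ₀(0)Y = DΨ₀(0)Y′ ⟹ Q̄_{k+1}(1)Y = Q̄_{k+1}(1)Y′`. [cite: Balaban1985Variational, (44)–(45) p.285, (81)–(83) p.290] -/
theorem qLin_eq_of_fderiv_msChart_flat_eq (K k : ℕ) (Y Y' : PBond (F.P K) 0 → lieSU (Fin 2))
    (h : fderiv ℝ (msChart F 2 K (k + 1) (atScale (k + 1)) (avgFamily (avOfRecord F 2 K) 1) (1 : GaugeField (F.P K) 0 (SU 2))) 0 Y =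
      fderiv ℝ (msChart F 2 K (k + 1) (atScale (k + 1)) (avgFamily (avOfRecord F 2 K) 1) (1 : GaugeField (F.P K) 0 (SU 2))) 0 Y')
    (c : PBond (F.P K) (k + 1)) :
    qLin (k + 1) (1 : GaugeField (F.P K) 0 (SU 2)) Y c = qLin (k + 1) (1 : GaugeField (F.P K) 0 (SU 2)) Y' c := by
  have hc : c ∈ bondsOf ((atScale (k + 1) : DetSet (F.P K)) (k + 1)) := by simp [atScale, bondsOf]
  set s : ConstrSet (atScale (k + 1) : DetSet (F.P K)) (k + 1) := ⟨⟨k + 1, Nat.lt_succ_self _⟩, ⟨c, hc⟩⟩ with hs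
  set i := constrEnum (atScale (k + 1) : DetSet (F.P K)) (k + 1) s with hi
  have hsymm : (constrEnum (atScale (k + 1) : DetSet (F.P K)) (k + 1)).symm i = s := by rw [hi, Equiv.symm_apply_apply]
  have hA : ∀ Z : PBond (F.P K) 0 → lieSU (Fin 2),
      fderiv ℝ (msChart F 2 K (k + 1) (atScale (k + 1)) (avgFamily (avOfRecord F 2 K) 1) (1 : GaugeField (F.P K) 0 (SU 2))) 0 Z i =
        suProj 2 (qLin (k + 1) (1 : GaugeField (F.P K) 0 (SU 2)) Z c) := fun Z => by
    rw [fderiv_msChart_apply_eq_suProj_qLin_of_smallBelow (smallBelow_avOfRecord_one F 2 (k + 1)) (atScale (k + 1)) Z i, hsymm]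
  have key := congrFun h i
  rw [hA, hA] at key
  have h1 := congrArg Subtype.val key
  rwa [coe_suProj_of_mem (qLin_mem_lieSU (smallBelow_avOfRecord_one F 2 (k + 1)) Y c),
    coe_suProj_of_mem (qLin_mem_lieSU (smallBelow_avOfRecord_one F 2 (k + 1)) Y' c)] at h1

/-- ★★ **THE FIRST-ORDER READING OF THE KNIT `range` TOKEN** `Ū^{k+1}(expChart 1 (X B)) = unitField B` (members-in-fibres, ✓`eventually_avgFamily_expChart_eq_unitField`): differentiated at
`B = 0` through the flat log chart, the Lie presentation's velocity `X_{a,l} := DX(0)(respDir a l)` has contour-linearised average `Q̄_{k+1}(1) X_{a,l} = δ_{c,l}·ρ₈(bV a)` — the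
value row of the K0 constraint. [cite: Balaban1985Variational, (44)–(45) p.285, (15) p.280, Prop. 9 p.309; Balaban1987RG1, (1.20) p.264, (4.35) p.290] -/
theorem qLin_fderiv_respDir_eq (K k : ℕ)
    (hρ8 : letI := θ.instVβ₁; letI := θ.instVβ₂; ∀ v : θ.Vβ, θ.ρ8 v ∈ lieSU (Fin 2))
    (X : (Fin (F.P K).d → Site (F.P K) (k + 1) → θ.Vβ) → PBond (F.P K) 0 → lieSU (Fin 2))
    (hX₀ : letI := θ.instVβ₁; letI := θ.instVβ₂; X 0 = 0) (hXd : letI := θ.instVβ₁; letI := θ.instVβ₂; DifferentiableAt ℝ X 0)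
    (hV : letI := θ.instVβ₁; letI := θ.instVβ₂;
      ∀ᶠ B in 𝓝 (0 : Fin (F.P K).d → Site (F.P K) (k + 1) → θ.Vβ),
        avgFamily (avOfRecord F 2 K) (expChart (1 : GaugeField (F.P K) 0 (SU 2)) (X B)) (k + 1) = unitField F θ k K B)
    (a : θ.ιβ) (l : RespLabel F k K) (c : PBond (F.P K) (k + 1)) :
    letI := θ.instVβ₁; letI := θ.instVβ₂
    qLin (k + 1) (1 : GaugeField (F.P K) 0 (SU 2)) (fderiv ℝ X 0 (respDir F θ k K a l)) c =
      if c = ⟨l.2, l.1⟩ then θ.ρ8 (θ.bV a) else 0 := by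
  letI := θ.instVβ₁; letI := θ.instVβ₂
  set Ψ₀ := msChart F 2 K (k + 1) (atScale (k + 1)) (avgFamily (avOfRecord F 2 K) 1) (1 : GaugeField (F.P K) 0 (SU 2)) with hΨ₀
  have hc : c ∈ bondsOf ((atScale (k + 1) : DetSet (F.P K)) (k + 1)) := by simp [atScale, bondsOf]
  set s : ConstrSet (atScale (k + 1) : DetSet (F.P K)) (k + 1) := ⟨⟨k + 1, Nat.lt_succ_self _⟩, ⟨c, hc⟩⟩ with hs
  set i := constrEnum (atScale (k + 1) : DetSet (F.P K)) (k + 1) s with hi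
  have hsymm : (constrEnum (atScale (k + 1) : DetSet (F.P K)) (k + 1)).symm i = s := by rw [hi, Equiv.symm_apply_apply]
  -- (A) the chart derivative at the index of `c`
  have hA : ∀ Z : PBond (F.P K) 0 → lieSU (Fin 2), fderiv ℝ Ψ₀ 0 Z i = suProj 2 (qLin (k + 1) (1 : GaugeField (F.P K) 0 (SU 2)) Z c) :=
    fun Z => by
    rw [hΨ₀, fderiv_msChart_apply_eq_suProj_qLin_of_smallBelow (smallBelow_avOfRecord_one F 2 (k + 1)) (atScale (k + 1)) Z i, hsymm]
  -- (B) the reference averages are flat: `Ū^{k+1}(1) = 1` (the token at `B = 0`)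
  have hW1 : avgFamily (avOfRecord F 2 K) (1 : GaugeField (F.P K) 0 (SU 2)) (k + 1) = 1 := by
    have h0 := hV.self_of_nhds
    rwa [hX₀, expChart_zero, unitField_zero] at h0
  -- (C) near `0` the datum coordinate `B ↦ Ψ₀ (X B) i` IS the continuous linear map `B ↦ suProj (ρ₈ (B c.dir c.src))`
  set G : (Fin (F.P K).d → Site (F.P K) (k + 1) → θ.Vβ) →L[ℝ] lieSU (Fin 2) :=
    (suProj 2).comp (θ.ρ8.comp ((ContinuousLinearMap.proj c.src).comp
      (ContinuousLinearMap.proj (R := ℝ) (φ := fun _ : Fin (F.P K).d => Site (F.P K) (k + 1) → θ.Vβ) c.dir))) with hG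
  have hGapp : ∀ B, G B = suProj 2 (θ.ρ8 (B c.dir c.src)) := fun B => rfl
  have hsmall : ∀ᶠ B in 𝓝 (0 : Fin (F.P K).d → Site (F.P K) (k + 1) → θ.Vβ), ‖θ.ρ8 (B c.dir c.src)‖ < Real.log 2 := by
    have hcont : Continuous fun B : Fin (F.P K).d → Site (F.P K) (k + 1) → θ.Vβ => ‖θ.ρ8 (B c.dir c.src)‖ :=
      (θ.ρ8.continuous.comp ((continuous_apply c.src).comp (continuous_apply c.dir))).norm
    have h0 : ‖θ.ρ8 ((0 : Fin (F.P K).d → Site (F.P K) (k + 1) → θ.Vβ) c.dir c.src)‖ < Real.log 2 := by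
      rw [Pi.zero_apply, Pi.zero_apply, map_zero, norm_zero]; exact Real.log_pos one_lt_two
    exact hcont.continuousAt.eventually_lt continuousAt_const h0
  have hf : ∀ᶠ B in 𝓝 (0 : Fin (F.P K).d → Site (F.P K) (k + 1) → θ.Vβ), Ψ₀ (X B) i = G B := by
    filter_upwards [hV, hsmall] with B hB hsm
    rw [hGapp, hΨ₀, msChart_apply, hsymm]
    show suProj 2 (mlog (relAvg K (avgFamily (avOfRecord F 2 K) 1) (expChart (1 : GaugeField (F.P K) 0 (SU 2)) (X B)) (k + 1) c)) = _
    have hu : ((unitField F θ k K B c : SU 2) : Matrix (Fin 2) (Fin 2) ℂ) = NormedSpace.exp (θ.ρ8 (B c.dir c.src)) := by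
      show ((suOfMat 2 (NormedSpace.exp (θ.ρ8 (B c.dir c.src))) : SU 2) : Matrix (Fin 2) (Fin 2) ℂ) = _
      rw [suOfMat_of_mem (exp_mem_specialUnitaryGroup_of_mem_lieSU (hρ8 _))]
    have h1c : (((1 : GaugeField (F.P K) (k + 1) (SU 2)) c : SU 2) : Matrix (Fin 2) (Fin 2) ℂ) = 1 := rfl
    rw [relAvg, hB, hW1, hu, h1c, star_one, one_mul, mlog_exp hsm]
  -- (D) two Fréchet derivatives of the same germ: the CLM `G` and the chain rule `proj_i ∘ DΨ₀(0) ∘ DX(0)`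
  have hΨd : DifferentiableAt ℝ Ψ₀ 0 := (contDiffAt_msChart_flat F K k).differentiableAt (by simp)
  have hΨX : HasFDerivAt Ψ₀ (fderiv ℝ Ψ₀ 0) (X 0) := by rw [hX₀]; exact hΨd.hasFDerivAt
  have hcomp : HasFDerivAt (fun B => Ψ₀ (X B)) ((fderiv ℝ Ψ₀ 0).comp (fderiv ℝ X 0)) 0 := hΨX.comp 0 hXd.hasFDerivAt
  have hcompi : HasFDerivAt (fun B => Ψ₀ (X B) i) ((ContinuousLinearMap.proj i).comp ((fderiv ℝ Ψ₀ 0).comp (fderiv ℝ X 0))) 0 :=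
    hasFDerivAt_pi'.1 hcomp i
  have hfd : HasFDerivAt (fun B => Ψ₀ (X B) i) G 0 := G.hasFDerivAt.congr_of_eventuallyEq hf
  have huniq : G = (ContinuousLinearMap.proj i).comp ((fderiv ℝ Ψ₀ 0).comp (fderiv ℝ X 0)) := hfd.unique hcompi
  have key : suProj 2 (θ.ρ8 (respDir F θ k K a l c.dir c.src)) =
      suProj 2 (qLin (k + 1) (1 : GaugeField (F.P K) 0 (SU 2)) (fderiv ℝ X 0 (respDir F θ k K a l)) c) := by
    have h1 := congrArg (fun T : (Fin (F.P K).d → Site (F.P K) (k + 1) → θ.Vβ) →L[ℝ] lieSU (Fin 2) => T (respDir F θ k K a l)) huniq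
    simp only [ContinuousLinearMap.coe_comp, Function.comp_apply, ContinuousLinearMap.proj_apply] at h1
    rw [hGapp] at h1
    rw [h1, hA]
  -- (E) strip `suProj` (both arguments are in `𝔰𝔲(2)`) and evaluate the response direction
  have h2 := congrArg Subtype.val key
  rw [coe_suProj_of_mem (hρ8 _), coe_suProj_of_mem (qLin_mem_lieSU (smallBelow_avOfRecord_one F 2 (k + 1)) _ c)] at h2
  rw [← h2, ρ8_respDir_apply]

end DatumVelocity

end Summit.QuantumFields.YangMills.Theorems.K0AxCtabUniq

end
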